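import Literature.Probability.LatticeModels.PSContourSetup
import HarnessLib

/-!
# Random-cluster contours, I: good and bad sites, thick supports, volumes

Topic `Literature/Probability/LatticeModels`. The site-contours of the random-cluster model on `ℤ^d`
used for the Pirogov–Sinai proof of the first-order transition (Laanait–Messager–Miracle-Solé–
Ruiz–Shlosman 1991; Grimmett 2006, §7.5), set up *à la* Friedli–Velenik §7.2 (thick contours for
`d_∞`) with the edge variables of the random-cluster model in place of spins:

* a *finitary configuration* `(σ, F, ω)`: the edges of the finite set `F` that are open are those of
  `ω ⊆ F`, every other nearest-neighbour edge of `ℤ^d` is open iff the phase `σ` is `ord`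
  (`EOpen`);
* a site `x` is `ord`-good (resp. `dis`-good) if every edge with both endpoints in the `★`-ball
  `B∞(x,1)` is open (resp. closed), and *bad* otherwise (FV §7.2.1: `#`-correct / incorrect sites);
  the bad sites form a finite set (`badFinset`); the **thick bad set** `⋃_{x bad} B∞(x,1)` (`thick`,
  FV's `Γ(ω)` of (7.14)) splits into `★`-components, the **supports** of the contours of `ω`
  (`supports`, FV Def. 7.18);
* **volumes**: `core V = {i : B∞(i,2) ⊆ V}`, `inner1 V = {i : B∞(i,1) ⊆ V}` and the free edges
  `freeEdges V = {e : coBall e ⊆ core V}`; a configuration of the volume `V` with boundary condition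
  `σ` is `(σ, freeEdges V, ω)` with `ω ⊆ freeEdges V`, and then (the random-cluster form of FV
  Lemma 7.20) its bad sites lie in `core V`, its thick bad set in `inner1 V`, and each support `S`
  satisfies `d_∞(S, Vᶜ) > 1`.

Everything is proved; no named facts.

## References

* S. Friedli, Y. Velenik, *Statistical Mechanics of Lattice Systems*, CUP 2017, §7.2.1 (correct and
  incorrect sites, eq. (7.14)), §7.2.6 (Def. 7.18), §7.3 (Ω^#_Λ, Lemma 7.20). [FriedliVelenik2017]
* G. Grimmett, *The Random-Cluster Model*, Springer 2006, §7.5 (contours of the random-cluster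
  model). [Grimmett2006]
-/

noncomputable section

open Finset Relation

namespace Literature.Probability.LatticeModels

namespace RCC

variable {d : ℕ}

/-! ### Nearest-neighbour edges inside finite sets -/

/-- The `2d` lattice neighbours of a site, as a finset. [folklore] -/
def nbrs (x : Site d) : Finset (Site d) := (starBall x).filter fun y => (zdGraph d).Adj x y

/-- Membership in `nbrs`. [folklore] -/
theorem mem_nbrs {x y : Site d} : y ∈ nbrs x ↔ (zdGraph d).Adj x y := by
  rw [nbrs, mem_filter]
  exact ⟨fun h => h.2, fun h => ⟨(adj_iff_mem_starBall.1 (zdGraph_le_zdStar h)).1, h⟩⟩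

/-- `|nbrs x| ≤ 3^d`. [folklore] -/
theorem card_nbrs_le (x : Site d) : #(nbrs x) ≤ 3 ^ d :=
  (card_le_card (filter_subset _ _)).trans (card_starBall x).le

/-- The nearest-neighbour edges of `ℤ^d` with both endpoints in the finite set `A` (Grimmett's `E_A`).
[cite: Grimmett2006, §4.2 (E_Λ)] -/
def nnEdges (A : Finset (Site d)) : Finset (Sym2 (Site d)) :=
  A.biUnion fun x => ((nbrs x).filter (· ∈ A)).image fun y => s(x, y)

/-- Membership in `nnEdges`. [folklore] -/
theorem mem_nnEdges {A : Finset (Site d)} {e : Sym2 (Site d)} :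
    e ∈ nnEdges A ↔ e ∈ (zdGraph d).edgeSet ∧ ∀ z ∈ e, z ∈ A := by
  constructor
  · intro h
    obtain ⟨x, hx, h⟩ := mem_biUnion.1 h
    obtain ⟨y, hy, rfl⟩ := mem_image.1 h
    obtain ⟨hy, hyA⟩ := mem_filter.1 hy
    exact ⟨(SimpleGraph.mem_edgeSet _).2 (mem_nbrs.1 hy), fun z hz => by
      rcases Sym2.mem_iff.1 hz with rfl | rfl <;> assumption⟩
  · intro ⟨he, hA⟩
    induction e using Sym2.ind with
    | h x y =>
      rw [SimpleGraph.mem_edgeSet] at he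
      exact mem_biUnion.2 ⟨x, hA x (Sym2.mem_mk_left x y), mem_image.2 ⟨y, mem_filter.2 ⟨mem_nbrs.2 he,
        hA y (Sym2.mem_mk_right x y)⟩, rfl⟩⟩

/-- `s(x,y) ∈ nnEdges A` iff `x ~ y` and both lie in `A`. [folklore] -/
theorem mk_mem_nnEdges {A : Finset (Site d)} {x y : Site d} :
    s(x, y) ∈ nnEdges A ↔ (zdGraph d).Adj x y ∧ x ∈ A ∧ y ∈ A := by
  rw [mem_nnEdges, SimpleGraph.mem_edgeSet]
  constructor
  · rintro ⟨h, hA⟩; exact ⟨h, hA x (Sym2.mem_mk_left x y), hA y (Sym2.mem_mk_right x y)⟩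
  · rintro ⟨h, hx, hy⟩; exact ⟨h, fun z hz => by rcases Sym2.mem_iff.1 hz with rfl | rfl <;> assumption⟩

/-- `nnEdges` is monotone. [folklore] -/
theorem nnEdges_mono {A B : Finset (Site d)} (h : A ⊆ B) : nnEdges A ⊆ nnEdges B := fun e he => by
  rw [mem_nnEdges] at he ⊢; exact ⟨he.1, fun z hz => h (he.2 z hz)⟩

/-- `|nnEdges A| ≤ 3^d |A|`. [folklore] -/
theorem card_nnEdges_le (A : Finset (Site d)) : #(nnEdges A) ≤ 3 ^ d * #A := by
  refine card_biUnion_le.trans ?_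
  rw [mul_comm, ← smul_eq_mul, ← sum_const]
  exact sum_le_sum fun x _ => card_image_le.trans ((card_le_card (filter_subset _ _)).trans (card_nbrs_le x))

/-- The **co-ball** of a pair: the sites whose `★`-ball contains both points (`B∞(u,1) ∩ B∞(v,1)`).
[cite: FriedliVelenik2017, §7.2.1 (i + B(1))] -/
def coBall : Sym2 (Site d) → Finset (Site d) :=
  Sym2.lift ⟨fun u v => starBall u ∩ starBall v, fun _ _ => inter_comm _ _⟩

/-- The co-ball of `s(u, v)`. [folklore] -/
@[simp] theorem coBall_mk (u v : Site d) : coBall s(u, v) = starBall u ∩ starBall v := rfl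

/-- `x ∈ coBall e` iff both points of `e` lie in `B∞(x,1)`. [folklore] -/
theorem mem_coBall_iff {e : Sym2 (Site d)} {x : Site d} : x ∈ coBall e ↔ ∀ z ∈ e, z ∈ starBall x := by
  induction e using Sym2.ind with
  | h u v =>
    rw [coBall_mk, mem_inter, mem_starBall_comm (x := u), mem_starBall_comm (x := v)]
    constructor
    · rintro ⟨hu, hv⟩ z hz; rcases Sym2.mem_iff.1 hz with rfl | rfl <;> assumption
    · intro h; exact ⟨h u (Sym2.mem_mk_left u v), h v (Sym2.mem_mk_right u v)⟩

/-- The points of a pair lie in its co-ball. [folklore] -/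
theorem mem_coBall_of_mem {e : Sym2 (Site d)} (he : e ∈ (zdGraph d).edgeSet) {z : Site d} (hz : z ∈ e) : z ∈ coBall e := by
  rw [mem_coBall_iff]
  intro w hw
  induction e using Sym2.ind with
  | h u v =>
    rw [SimpleGraph.mem_edgeSet] at he
    have huv : v ∈ starBall u := (adj_iff_mem_starBall.1 (zdGraph_le_zdStar he)).1
    rcases Sym2.mem_iff.1 hz with rfl | rfl <;> rcases Sym2.mem_iff.1 hw with rfl | rfl
    · exact mem_starBall_self _
    · exact huv
    · exact mem_starBall_comm.1 huv
    · exact mem_starBall_self _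

/-- The edges of the `★`-ball `B∞(x,1)`: the nearest-neighbour edges with both endpoints within
`d_∞`-distance `1` of `x`. [cite: FriedliVelenik2017, §7.2.1 (#-correct at i: ω_j = η_j for all j ∈ i + B(1))] -/
def ballEdges (x : Site d) : Finset (Sym2 (Site d)) := nnEdges (starBall x)

/-- Membership in `ballEdges`. [folklore] -/
theorem mem_ballEdges_iff {x : Site d} {e : Sym2 (Site d)} : e ∈ ballEdges x ↔ e ∈ (zdGraph d).edgeSet ∧ x ∈ coBall e := by
  rw [ballEdges, mem_nnEdges, mem_coBall_iff]

/-! ### Finitary configurations; good and bad sites -/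

/-- **Openness of an edge in the finitary configuration `(σ, F, ω)`**: the open edges are those of
`ω`, together with all edges outside `F` when the phase `σ` is `ord`.
[cite: FriedliVelenik2017, §7.3 (Ω^#_Λ: ω_i = η^#_i off Λ)] -/
def EOpen (σ : Phase) (F ω : Finset (Sym2 (Site d))) (e : Sym2 (Site d)) : Prop := e ∈ ω ∨ (e ∉ F ∧ σ = Phase.ord)

/-- Openness is decidable. [folklore] -/
instance (σ : Phase) (F ω : Finset (Sym2 (Site d))) (e : Sym2 (Site d)) : Decidable (EOpen σ F ω e) := by
  unfold EOpen; infer_instance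

/-- Inside `F` (for `ω ⊆ F`), open means `∈ ω`. [folklore] -/
theorem eOpen_iff_of_mem {σ : Phase} {F ω : Finset (Sym2 (Site d))} {e : Sym2 (Site d)} (he : e ∈ F) :
    EOpen σ F ω e ↔ e ∈ ω := by
  unfold EOpen; tauto

/-- Outside `F` (for `ω ⊆ F`), open means `σ = ord`. [folklore] -/
theorem eOpen_iff_of_not_mem {σ : Phase} {F ω : Finset (Sym2 (Site d))} (hω : ω ⊆ F) {e : Sym2 (Site d)} (he : e ∉ F) :
    EOpen σ F ω e ↔ σ = Phase.ord := by
  unfold EOpen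
  exact ⟨fun h => h.elim (fun h' => absurd (hω h') he) And.right, fun h => Or.inr ⟨he, h⟩⟩

/-- `x` is **`ord`-good** (all edges of its ball are open; FV: `ord`-correct). [cite: FriedliVelenik2017, §7.2.1] -/
def OrdGood (σ : Phase) (F ω : Finset (Sym2 (Site d))) (x : Site d) : Prop := ∀ e ∈ ballEdges x, EOpen σ F ω e

/-- `x` is **`dis`-good** (all edges of its ball are closed; FV: `dis`-correct). [cite: FriedliVelenik2017, §7.2.1] -/
def DisGood (σ : Phase) (F ω : Finset (Sym2 (Site d))) (x : Site d) : Prop := ∀ e ∈ ballEdges x, ¬ EOpen σ F ω e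

/-- `x` is **bad** (neither `ord`- nor `dis`-good; FV: incorrect). [cite: FriedliVelenik2017, §7.2.1 (ℬ(ω))] -/
def Bad (σ : Phase) (F ω : Finset (Sym2 (Site d))) (x : Site d) : Prop := ¬ OrdGood σ F ω x ∧ ¬ DisGood σ F ω x

/-- Goodness of type `τ`. [cite: FriedliVelenik2017, §7.2.1] -/
def Good (σ : Phase) (F ω : Finset (Sym2 (Site d))) (τ : Phase) (x : Site d) : Prop :=
  match τ with
  | Phase.ord => OrdGood σ F ω x
  | Phase.dis => DisGood σ F ω x

/-- `ord`-goodness is decidable. [folklore] -/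
instance (σ : Phase) (F ω : Finset (Sym2 (Site d))) (x : Site d) : Decidable (OrdGood σ F ω x) := by
  unfold OrdGood; infer_instance

/-- `dis`-goodness is decidable. [folklore] -/
instance (σ : Phase) (F ω : Finset (Sym2 (Site d))) (x : Site d) : Decidable (DisGood σ F ω x) := by
  unfold DisGood; infer_instance

/-- Badness is decidable. [folklore] -/
instance (σ : Phase) (F ω : Finset (Sym2 (Site d))) (x : Site d) : Decidable (Bad σ F ω x) := by
  unfold Bad; infer_instance

variable {σ : Phase} {F ω : Finset (Sym2 (Site d))}

/-- Every ball contains an edge (for `d ≥ 1`). [folklore] -/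
theorem ballEdges_nonempty (hd : 1 ≤ d) (x : Site d) : (ballEdges x).Nonempty := by
  set i : Fin d := ⟨0, hd⟩
  refine ⟨s(x, Function.update x i (x i + 1)), mem_ballEdges_iff.2 ⟨(SimpleGraph.mem_edgeSet _).2 ?_, ?_⟩⟩
  · have := adj_update_succ x i (x i)
    rw [Function.update_eq_self] at this
    refine (zdGraph_adj_iff _ _).2 ⟨i, Or.inl (funext fun j => ?_)⟩
    by_cases hj : j = i
    · subst hj; simp
    · simp [Function.update_of_ne hj, Pi.single_eq_of_ne hj]
  · rw [coBall_mk, mem_inter]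
    refine ⟨mem_starBall_self x, mem_starBall_comm.1 (mem_starBall.2 (supDist_le_iff.2 fun j => ?_))⟩
    by_cases hj : j = i
    · subst hj; simp
    · simp [Function.update_of_ne hj]

/-- A site is not both `ord`-good and `dis`-good (`d ≥ 1`). [folklore] -/
theorem not_ordGood_of_disGood (hd : 1 ≤ d) {x : Site d} (h : DisGood σ F ω x) : ¬ OrdGood σ F ω x := fun h' => by
  obtain ⟨e, he⟩ := ballEdges_nonempty hd x
  exact h e he (h' e he)

/-- A bad site has an open and a closed edge in its ball. [cite: FriedliVelenik2017, §7.2.1] -/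
theorem bad_iff {x : Site d} : Bad σ F ω x ↔ (∃ e ∈ ballEdges x, ¬ EOpen σ F ω e) ∧ ∃ e ∈ ballEdges x, EOpen σ F ω e := by
  unfold Bad OrdGood DisGood
  push Not
  rfl

/-- A bad site sees an edge of `F ∪ ω` in its ball (when `ω ⊆ F`: a non-default edge). [folklore] -/
theorem exists_mem_union_of_bad (hω : ω ⊆ F) {x : Site d} (hx : Bad σ F ω x) : ∃ e ∈ ballEdges x, e ∈ F ∪ ω := by
  obtain ⟨⟨e₁, he₁, hc⟩, e₂, he₂, ho⟩ := bad_iff.1 hx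
  cases σ with
  | ord =>
    refine ⟨e₁, he₁, mem_union.2 (Or.inl ?_)⟩
    by_contra h
    exact hc ((eOpen_iff_of_not_mem hω h).2 rfl)
  | dis =>
    refine ⟨e₂, he₂, mem_union.2 (Or.inl ?_)⟩
    by_contra h
    exact absurd ((eOpen_iff_of_not_mem hω h).1 ho) (by decide)

variable (σ F ω) in
/-- **The bad sites**, as a finset (they all lie in the co-ball of an edge of `F ∪ ω`).
[cite: FriedliVelenik2017, §7.2.1 (ℬ(ω))] -/
def badFinset : Finset (Site d) := ((F ∪ ω).biUnion coBall).filter (Bad σ F ω)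

/-- Membership in `badFinset` is badness (`ω ⊆ F`). [cite: FriedliVelenik2017, §7.2.1] -/
theorem mem_badFinset (hω : ω ⊆ F) {x : Site d} : x ∈ badFinset σ F ω ↔ Bad σ F ω x := by
  rw [badFinset, mem_filter, mem_biUnion]
  refine ⟨fun h => h.2, fun h => ⟨?_, h⟩⟩
  obtain ⟨e, he, heF⟩ := exists_mem_union_of_bad hω h
  exact ⟨e, heF, (mem_ballEdges_iff.1 he).2⟩

variable (σ F ω) in
/-- **The thick bad set** `Γ(ω) = ⋃_{x bad} B∞(x,1)`. [cite: FriedliVelenik2017, §7.2.1, eq. (7.14) and §7.3 (Γ(ω))] -/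
def thick : Finset (Site d) := (badFinset σ F ω).biUnion starBall

/-- Membership in the thick bad set. [cite: FriedliVelenik2017, eq. (7.14)] -/
theorem mem_thick (hω : ω ⊆ F) {y : Site d} : y ∈ thick σ F ω ↔ ∃ b, Bad σ F ω b ∧ y ∈ starBall b := by
  rw [thick, mem_biUnion]
  exact ⟨fun ⟨b, hb, hy⟩ => ⟨b, (mem_badFinset hω).1 hb, hy⟩, fun ⟨b, hb, hy⟩ => ⟨b, (mem_badFinset hω).2 hb, hy⟩⟩

/-- Bad sites are thick. [folklore] -/
theorem mem_thick_of_bad (hω : ω ⊆ F) {b : Site d} (hb : Bad σ F ω b) : b ∈ thick σ F ω :=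
  (mem_thick hω).2 ⟨b, hb, mem_starBall_self b⟩

/-- **A site off the thick bad set has a good ball**: no site of its `★`-ball is bad.
[cite: FriedliVelenik2017, §7.2.6 (vertices of ∂^ex γ̄ are correct)] -/
theorem not_bad_of_not_mem_thick (hω : ω ⊆ F) {y : Site d} (hy : y ∉ thick σ F ω) {z : Site d} (hz : z ∈ starBall y) :
    ¬ Bad σ F ω z := fun hzb =>
  hy ((mem_thick hω).2 ⟨z, hzb, mem_starBall_comm.1 hz⟩)

/-! ### Supports: the `★`-components of the thick bad set -/

variable (σ F ω) in
/-- The `★`-component of the thick bad set through `z`. [cite: FriedliVelenik2017, §7.2.6 (maximal connected components of Γ(ω))] -/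
def suppAt (z : Site d) : Finset (Site d) :=
  by classical exact (thick σ F ω).filter fun y => ReflTransGen (starRel (thick σ F ω : Set (Site d))) z y

variable (σ F ω) in
/-- **The supports of the contours of `ω`**: the `★`-components of the thick bad set (FV Def. 7.18).
[cite: FriedliVelenik2017, §7.2.6, Def. 7.18] -/
def supports : Finset (Finset (Site d)) := (thick σ F ω).image (suppAt σ F ω)

/-- Membership in `suppAt`. [folklore] -/
theorem mem_suppAt {z y : Site d} (hz : z ∈ thick σ F ω) :
    y ∈ suppAt σ F ω z ↔ ReflTransGen (starRel (thick σ F ω : Set (Site d))) z y := by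
  classical
  rw [suppAt, mem_filter]
  exact ⟨fun h => h.2, fun h => ⟨mem_coe.1 (mem_of_reflTransGen_starRel h (mem_coe.2 hz)), h⟩⟩

/-- A component lies in the thick bad set. [folklore] -/
theorem suppAt_subset (z : Site d) : suppAt σ F ω z ⊆ thick σ F ω := by
  classical
  exact filter_subset _ _

/-- The base point lies in its component. [folklore] -/
theorem mem_suppAt_self {z : Site d} (hz : z ∈ thick σ F ω) : z ∈ suppAt σ F ω z := (mem_suppAt hz).2 ReflTransGen.refl

/-- Components are closed under `★`-steps in the thick bad set (maximality). [cite: FriedliVelenik2017, §7.2.6] -/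
theorem mem_suppAt_of_adj {z x y : Site d} (hz : z ∈ thick σ F ω) (hx : x ∈ suppAt σ F ω z) (hy : y ∈ thick σ F ω)
    (hxy : (zdStar d).Adj x y) : y ∈ suppAt σ F ω z :=
  (mem_suppAt hz).2 (((mem_suppAt hz).1 hx).tail ⟨hxy, mem_coe.2 (suppAt_subset z hx), mem_coe.2 hy⟩)

/-- Components through chained points coincide. [folklore] -/
theorem suppAt_eq_of_mem {z y : Site d} (hz : z ∈ thick σ F ω) (hy : y ∈ suppAt σ F ω z) : suppAt σ F ω y = suppAt σ F ω z := by
  have hy' : y ∈ thick σ F ω := suppAt_subset z hy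
  have hzy := (mem_suppAt hz).1 hy
  ext w
  rw [mem_suppAt hy', mem_suppAt hz]
  exact ⟨fun h => hzy.trans h, fun h => (reflTransGen_starRel_symm hzy).trans h⟩

/-- **Supports are `★`-connected.** [cite: FriedliVelenik2017, §7.2.6, Def. 7.18] -/
theorem starConn_suppAt {z : Site d} (hz : z ∈ thick σ F ω) : StarConn (suppAt σ F ω z : Set (Site d)) := by
  intro a ha b hb
  have hab : ReflTransGen (starRel (thick σ F ω : Set (Site d))) a b :=
    (reflTransGen_starRel_symm ((mem_suppAt hz).1 (mem_coe.1 ha))).trans ((mem_suppAt hz).1 (mem_coe.1 hb))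
  exact reflTransGen_starRel_restrict (fun a ha b hab => mem_coe.2 (mem_suppAt_of_adj hz (mem_coe.1 ha) (mem_coe.1 hab.2.2) hab.1))
    ha hab

/-- Membership in `supports`. [folklore] -/
theorem mem_supports {S : Finset (Site d)} : S ∈ supports σ F ω ↔ ∃ z ∈ thick σ F ω, suppAt σ F ω z = S := by
  rw [supports, mem_image]

/-- **Basic properties of a support**: it lies in the thick bad set, is non-empty and `★`-connected,
and is closed under `★`-steps in the thick bad set. [cite: FriedliVelenik2017, §7.2.6, Def. 7.18] -/
theorem support_props {S : Finset (Site d)} (hS : S ∈ supports σ F ω) :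
    S ⊆ thick σ F ω ∧ S.Nonempty ∧ StarConn (S : Set (Site d)) ∧
      ∀ x ∈ S, ∀ y ∈ thick σ F ω, (zdStar d).Adj x y → y ∈ S := by
  obtain ⟨z, hz, rfl⟩ := mem_supports.1 hS
  exact ⟨suppAt_subset z, ⟨z, mem_suppAt_self hz⟩, starConn_suppAt hz, fun x hx y hy hxy => mem_suppAt_of_adj hz hx hy hxy⟩

/-- The support through any of its points. [folklore] -/
theorem eq_suppAt_of_mem {S : Finset (Site d)} (hS : S ∈ supports σ F ω) {x : Site d} (hx : x ∈ S) : S = suppAt σ F ω x := by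
  obtain ⟨z, hz, rfl⟩ := mem_supports.1 hS
  exact (suppAt_eq_of_mem hz hx).symm

/-- **Distinct supports are at `d_∞`-distance `≥ 2`.** [cite: FriedliVelenik2017, §7.3, Def. 7.21 ("all contours of a configuration are compatible")] -/
theorem supDist_gt_one_of_ne {S S' : Finset (Site d)} (hS : S ∈ supports σ F ω) (hS' : S' ∈ supports σ F ω) (hne : S ≠ S')
    {x y : Site d} (hx : x ∈ S) (hy : y ∈ S') : 1 < supDist x y := by
  by_contra hle
  rw [not_lt] at hle
  obtain ⟨hS1, -, -, hS4⟩ := support_props hS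
  obtain ⟨hS'1, -, -, -⟩ := support_props hS'
  have hyS : y ∈ S := by
    by_cases hxy : x = y
    · exact hxy ▸ hx
    · exact hS4 x hx y (hS'1 hy) (zdStar_adj.2 ⟨hxy, hle⟩)
  exact hne ((eq_suppAt_of_mem hS hyS).trans (eq_suppAt_of_mem hS' hy).symm)

/-- The thick bad set is the union of the supports. [folklore] -/
theorem mem_thick_iff_exists_support {y : Site d} : y ∈ thick σ F ω ↔ ∃ S ∈ supports σ F ω, y ∈ S :=
  ⟨fun hy => ⟨_, mem_supports.2 ⟨y, hy, rfl⟩, mem_suppAt_self hy⟩, fun ⟨_, hS, hy⟩ => (support_props hS).1 hy⟩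

/-- **A support is the thickening of its own bad sites**: `S = ⋃_{b ∈ S bad} B∞(b,1)`.
[cite: FriedliVelenik2017, §7.2.6] -/
theorem mem_support_iff_exists_bad (hω : ω ⊆ F) {S : Finset (Site d)} (hS : S ∈ supports σ F ω) {y : Site d} :
    y ∈ S ↔ ∃ b ∈ S, Bad σ F ω b ∧ y ∈ starBall b := by
  obtain ⟨hS1, -, -, hS4⟩ := support_props hS
  constructor
  · intro hy
    obtain ⟨b, hb, hyb⟩ := (mem_thick hω).1 (hS1 hy)
    refine ⟨b, ?_, hb, hyb⟩
    by_cases hby : y = b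
    · exact hby ▸ hy
    · exact hS4 y hy b (mem_thick_of_bad hω hb) (adj_iff_mem_starBall.2 ⟨mem_starBall_comm.1 hyb, hby⟩)
  · rintro ⟨b, hb, hbad, hyb⟩
    by_cases hby : b = y
    · exact hby ▸ hb
    · exact hS4 b hb y ((mem_thick hω).2 ⟨b, hbad, hyb⟩) (adj_iff_mem_starBall.2 ⟨hyb, hby⟩)

/-! ### Volumes and the free edges -/

/-- The `★`-ball of radius `2`. [cite: FriedliVelenik2017, §7.3, Lemma 7.20 (d_∞(j + B(1), Λᶜ))] -/
def starBall2 (x : Site d) : Finset (Site d) := Finset.Icc (x - 2) (x + 2)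

/-- Membership in the radius-`2` ball. [folklore] -/
theorem mem_starBall2 {x y : Site d} : y ∈ starBall2 x ↔ supDist x y ≤ 2 := by
  rw [starBall2, Finset.mem_Icc, supDist_le_iff, Pi.le_def, Pi.le_def]
  simp only [Pi.sub_apply, Pi.add_apply, Pi.ofNat_apply]
  constructor
  · rintro ⟨h1, h2⟩ i; have := h1 i; have := h2 i; omega
  · intro h; exact ⟨fun i => by have := h i; omega, fun i => by have := h i; omega⟩

/-- **The core of a volume**: the sites whose radius-`2` ball lies in the volume. [cite: FriedliVelenik2017, §7.3, Lemma 7.20] -/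
def core (V : Finset (Site d)) : Finset (Site d) := V.filter fun i => starBall2 i ⊆ V

/-- **The inner volume**: the sites whose `★`-ball lies in the volume. [cite: FriedliVelenik2017, §7.3 (d_∞(·, Λᶜ) > 1)] -/
def inner1 (V : Finset (Site d)) : Finset (Site d) := V.filter fun i => starBall i ⊆ V

/-- Membership in the core. [folklore] -/
theorem mem_core {V : Finset (Site d)} {i : Site d} : i ∈ core V ↔ starBall2 i ⊆ V := by
  rw [core, mem_filter]
  exact ⟨fun h => h.2, fun h => ⟨h (mem_starBall2.2 (by simp)), h⟩⟩

/-- Membership in the inner volume. [folklore] -/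
theorem mem_inner1 {V : Finset (Site d)} {i : Site d} : i ∈ inner1 V ↔ starBall i ⊆ V := by
  rw [inner1, mem_filter]
  exact ⟨fun h => h.2, fun h => ⟨h (mem_starBall_self i), h⟩⟩

/-- The ball of a core site lies in the inner volume. [folklore] -/
theorem starBall_subset_inner1_of_mem_core {V : Finset (Site d)} {i : Site d} (hi : i ∈ core V) : starBall i ⊆ inner1 V := by
  intro y hy
  refine mem_inner1.2 fun z hz => mem_core.1 hi (mem_starBall2.2 ?_)
  have h1 := mem_starBall.1 hy
  have h2 := mem_starBall.1 hz
  rw [supDist_le_iff] at h1 h2 ⊢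
  intro j; have := h1 j; have := h2 j; omega

/-- `core V ⊆ inner1 V ⊆ V`. [folklore] -/
theorem core_subset_inner1 (V : Finset (Site d)) : core V ⊆ inner1 V := fun _ hi =>
  starBall_subset_inner1_of_mem_core hi (mem_starBall_self _)

/-- `inner1 V ⊆ V`. [folklore] -/
theorem inner1_subset (V : Finset (Site d)) : inner1 V ⊆ V := filter_subset _ _

/-- **The free edges of a volume**: the edges whose co-ball lies in the core (only these may differ from
the boundary condition). [cite: FriedliVelenik2017, §7.3, Lemma 7.20 (ω_i = η^#_i whenever d_∞(i, Λᶜ) ≤ 3)] -/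
def freeEdges (V : Finset (Site d)) : Finset (Sym2 (Site d)) := (nnEdges V).filter fun e => coBall e ⊆ core V

/-- Membership in `freeEdges`. [folklore] -/
theorem mem_freeEdges {V : Finset (Site d)} {e : Sym2 (Site d)} :
    e ∈ freeEdges V ↔ e ∈ (zdGraph d).edgeSet ∧ coBall e ⊆ core V := by
  rw [freeEdges, mem_filter, mem_nnEdges]
  constructor
  · rintro ⟨⟨he, -⟩, hc⟩; exact ⟨he, hc⟩
  · rintro ⟨he, hc⟩
    exact ⟨⟨he, fun z hz => inner1_subset V (core_subset_inner1 V (hc (mem_coBall_of_mem he hz)))⟩, hc⟩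

/-- **Lemma 7.20, random-cluster form**: the bad sites of a configuration of the volume `V` lie in the
core of `V`. [cite: FriedliVelenik2017, §7.3, Lemma 7.20] -/
theorem bad_subset_core {V : Finset (Site d)} {ω : Finset (Sym2 (Site d))} (hω : ω ⊆ freeEdges V) {σ : Phase} {x : Site d}
    (hx : Bad σ (freeEdges V) ω x) : x ∈ core V := by
  obtain ⟨e, he, heF⟩ := exists_mem_union_of_bad hω hx
  rw [union_eq_left.2 hω] at heF
  exact (mem_freeEdges.1 heF).2 ((mem_ballEdges_iff.1 he).2)

/-- The thick bad set of a configuration of `V` lies in the inner volume. [cite: FriedliVelenik2017, §7.3, Lemma 7.20 (d_∞(Γ(ω), Λᶜ) > 1)] -/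
theorem thick_subset_inner1 {V : Finset (Site d)} {ω : Finset (Sym2 (Site d))} (hω : ω ⊆ freeEdges V) {σ : Phase} :
    thick σ (freeEdges V) ω ⊆ inner1 V := by
  intro y hy
  obtain ⟨b, hb, hyb⟩ := (mem_thick hω).1 hy
  exact starBall_subset_inner1_of_mem_core (bad_subset_core hω hb) hyb

/-- **Supports of a configuration of `V` keep their `★`-neighbourhood inside `V`** (`d_∞(S, Vᶜ) > 1`).
[cite: FriedliVelenik2017, §7.3 (Ω^#_Λ)] -/
theorem biUnion_starBall_subset_of_mem_supports {V : Finset (Site d)} {ω : Finset (Sym2 (Site d))} (hω : ω ⊆ freeEdges V)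
    {σ : Phase} {S : Finset (Site d)} (hS : S ∈ supports σ (freeEdges V) ω) : S.biUnion starBall ⊆ V := by
  intro z hz
  obtain ⟨y, hy, hzy⟩ := mem_biUnion.1 hz
  exact mem_inner1.1 (thick_subset_inner1 hω ((support_props hS).1 hy)) hzy

/-- A `dis`-good site of an `ord`-volume configuration lies in the core (its ball edges are free).
[cite: FriedliVelenik2017, §7.3, Lemma 7.20] -/
theorem mem_core_of_disGood (hd : 1 ≤ d) {V : Finset (Site d)} {ω : Finset (Sym2 (Site d))} (hω : ω ⊆ freeEdges V) {x : Site d}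
    (hx : DisGood Phase.ord (freeEdges V) ω x) : x ∈ core V := by
  obtain ⟨e, he⟩ := ballEdges_nonempty hd x
  have heF : e ∈ freeEdges V := by
    by_contra h
    exact hx e he ((eOpen_iff_of_not_mem hω h).2 rfl)
  exact (mem_freeEdges.1 heF).2 (mem_ballEdges_iff.1 he).2

/-- An `ord`-good site of a `dis`-volume configuration lies in the core. [cite: FriedliVelenik2017, §7.3, Lemma 7.20] -/
theorem mem_core_of_ordGood (hd : 1 ≤ d) {V : Finset (Site d)} {ω : Finset (Sym2 (Site d))} (hω : ω ⊆ freeEdges V) {x : Site d}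
    (hx : OrdGood Phase.dis (freeEdges V) ω x) : x ∈ core V := by
  obtain ⟨e, he⟩ := ballEdges_nonempty hd x
  have heF : e ∈ freeEdges V := by
    by_contra h
    exact absurd ((eOpen_iff_of_not_mem hω h).1 (hx e he)) (by decide)
  exact (mem_freeEdges.1 heF).2 (mem_ballEdges_iff.1 he).2

end RCC

end Literature.Probability.LatticeModels

end
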